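import Literature.NumberTheory.Automorphic.ProModularDeRhamClassicalGL2Q
import Literature.NumberTheory.Automorphic.PadicallyAutomorphicDetComplexConjugation
import HarnessLib

/-!
# `Pan2022_proModularDeRhamClassical_GL2Q` at the ODD primes is a corollary of the odd-prime
# Fontaine–Mazur fact; what remains is its dyadic instance

Topic `Literature/NumberTheory/Automorphic`; namespace `Literature.NumberTheory.Automorphic`.
A *proofs* file (theorems only; no definition, no named fact), sibling of
`ProModularDeRhamClassicalGL2Q` (the named fact `Pan2022_proModularDeRhamClassical_GL2Q`:
pro-modular + residually absolutely irreducible + regular de Rham `ρ : Γ_ℚ → GL₂(ℚ̄_p)` is a Tate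
twist of the Galois representation of a newform, at EVERY prime `p`) and of
`FontaineMazurGL2OddPrimeTateTwist` (the named fact `XZhang2024_fontaineMazurGL2_tateTwist`: the
Fontaine–Mazur theorem for `GL₂/ℚ` at every ODD prime — same conclusion, hypotheses "`p ≠ 2`,
`ρ` irreducible, ODD, unramified almost everywhere, regular de Rham").

* `proModularDeRhamClassical_GL2Q_of_ne_two`: for `p ≠ 2` the statement of
  `Pan2022_proModularDeRhamClassical_GL2Q` — even without its residual hypothesis — FOLLOWS from
  `XZhang2024_fontaineMazurGL2_tateTwist`, because a `p`-adically automorphic `ρ` is automatically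
  odd: `BigHeckeGLn.TameLevel.IsPadicallyAutomorphic.isOdd` (PROVED in
  `PadicallyAutomorphicDetComplexConjugation`: `-1 ∈ GL₂(ℚ)` is central and acts trivially on the
  cohomology of the arithmetic quotients, so the "nebentypus" of a continuous point of `𝕋(K^p)` is
  even and `det ρ(c) = ε_p(c) = -1`, by Kronecker–Weber and Dirichlet).
* `Pan2022_proModularDeRhamClassical_GL2Q.of_dyadic`: consequently the named fact is implied by
  `XZhang2024_fontaineMazurGL2_tateTwist` together with its own DYADIC instance (`p = 2`, stated
  verbatim as a hypothesis) — the genuinely new content of [Pan2022LocallyAnalyticII, Thm. 1.1.2]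
  with [PaskunasTung2021, Thm. 7.1] for the tree's debt census is the case `p = 2`, which no other
  fact of the tree covers (at `p = 2`, `Tung2020_fontaineMazurGL2_two_tateTwist` needs a residually
  NON-SOLVABLE image; the residually dihedral case is the open crux `DyadicOddResidue.DyadicDihedralFM`
  that consumes the fact).

This does not discharge `Pan2022_proModularDeRhamClassical_GL2Q` (both inputs are named facts of
their own); it records, as proved bookkeeping, that at odd `p` the fact carries no debt beyond
`XZhang2024_fontaineMazurGL2_tateTwist`.

## References

* L. Pan, arXiv:2209.06366 (2022), Thm. 1.1.2 (= Thm. 7.1.2). [Pan2022LocallyAnalyticII]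
* L. Pan, Forum Math. Pi 10 (2022) = arXiv:2008.07099, §6.1.1 ("`ρ_λ` … an odd semi-simple Galois
  representation"), Def. 6.1.2, Cor. 6.3.6. [Pan2022LocallyAnalytic]
* V. Paškūnas, S.-N. Tung, Forum Math. Sigma 9 (2021) e80, Thm. 7.1. [PaskunasTung2021]
* X. Zhang, arXiv:2412.06812 (2024), Thm. 1.0.2. [XZhang2024FontaineMazurP3]
-/

noncomputable section

open scoped MatrixGroups Matrix NumberField ModularForm
open NumberField IsDedekindDomain Field Filter CongruenceSubgroup

namespace Literature.NumberTheory.Automorphic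

open Literature.NumberTheory.GaloisRepresentations
open Literature.NumberTheory.EllipticCurves.ModularForms

/-- **At an odd prime, "pro-modular + regular de Rham ⟹ classical" is a case of the odd-prime
Fontaine–Mazur theorem**: for `p ≠ 2`, a continuous `ρ : Γ_ℚ → GL₂(ℚ̄_p)` which is irreducible,
unramified almost everywhere, de Rham at `p` with distinct labelled Hodge–Tate weights and
`p`-ADICALLY AUTOMORPHIC of some tame level is, up to a Tate twist, the Galois representation of a
newform — granted `XZhang2024_fontaineMazurGL2_tateTwist`, whose only further hypothesis, the
ODDNESS of `ρ`, is automatic for `p`-adically automorphic `ρ`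
(`BigHeckeGLn.TameLevel.IsPadicallyAutomorphic.isOdd`; [Pan2022LocallyAnalytic, §6.1.1]: "`ρ_λ` …
an odd … representation").  Same binders and VERBATIM the conclusion of
`Pan2022_proModularDeRhamClassical_GL2Q` at `p ≠ 2`, minus its (here unnecessary) residual
hypothesis. [cite: XZhang2024FontaineMazurP3, Thm. 1.0.2] [cite: Pan2022LocallyAnalytic, §6.1.1] -/
theorem proModularDeRhamClassical_GL2Q_of_ne_two (hX : XZhang2024_fontaineMazurGL2_tateTwist)
    (p : ℕ) [Fact p.Prime] (hp : p ≠ 2) (ρ : FramedGaloisRep ℚ (PadicAlgCl p) 2)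
    (hirr : ρ.toGaloisRep.IsIrreducible)
    (hunr : ∀ᶠ v : HeightOneSpectrum (𝓞 ℚ) in cofinite, ρ.IsUnramifiedAt v)
    (hdR : ∀ (v : HeightOneSpectrum (𝓞 ℚ)) (hv : ((p : ℕ) : 𝓞 ℚ) ∈ v.asIdeal),
      (PAdicHodge.fontainePstAdicCompletion v p hv).IsDeRhamFramed (ρ.toLocal v) ∧
      ∀ τ : v.adicCompletion ℚ →+* PadicAlgCl p, Continuous τ →
        (ρ.labelledHodgeTateWeightsAt v (PAdicHodge.fontainePstAdicCompletion v p hv).algebra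
          (PAdicHodge.fontainePstAdicCompletion v p hv).𝔅 τ).Nodup)
    (haut : ∃ 𝒰 : BigHeckeGLn.TameLevel 2 ℚ p, 𝒰.IsPadicallyAutomorphic ρ) :
    ∃ (χ : absoluteGaloisGroup ℚ →ₜ* (PadicAlgCl p)ˣ) (m : ℤ),
      (∀ σ, χ σ = cyclotomicPadicAlgCl ℚ p σ ^ m) ∧
      ∃ (N : ℕ) (_ : NeZero N) (k : ℤ) (f : CuspForm (Gamma1 N) k)
        (ιf : coeffCharField f →+* PadicAlgCl p),
        IsNewform1 f ∧ IsGaloisRepOfNewform1 f ιf {q | q ∣ N * p} (FramedRep.twist ρ χ) := by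
  obtain ⟨𝒰, h𝒰⟩ := haut
  exact hX p hp ρ hunr hirr (BigHeckeGLn.TameLevel.IsPadicallyAutomorphic.isOdd 𝒰 h𝒰) hdR

/-- **`Pan2022_proModularDeRhamClassical_GL2Q` = odd-prime Fontaine–Mazur + its dyadic instance.**
The named fact follows from `XZhang2024_fontaineMazurGL2_tateTwist` together with the statement
of the fact at `p = 2` alone (hypothesis `h2`, the body of `Pan2022_proModularDeRhamClassical_GL2Q`
specialised verbatim to `p = 2`): at `p ≠ 2` use `proModularDeRhamClassical_GL2Q_of_ne_two`.  So
for the debt census the fact's content beyond the odd-prime Fontaine–Mazur fact is exactly its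
DYADIC case — [Pan2022LocallyAnalyticII, Thm. 1.1.2] with [PaskunasTung2021, Thm. 7.1] at `p = 2`.
[cite: Pan2022LocallyAnalyticII, Thm. 1.1.2 (= Thm. 7.1.2)] [cite: PaskunasTung2021, Thm. 7.1]
[cite: XZhang2024FontaineMazurP3, Thm. 1.0.2] -/
theorem Pan2022_proModularDeRhamClassical_GL2Q.of_dyadic (hX : XZhang2024_fontaineMazurGL2_tateTwist)
    (h2 : ∀ (ρ : FramedGaloisRep ℚ (PadicAlgCl 2) 2),
      ρ.IsResiduallyAbsIrreducible → ρ.toGaloisRep.IsIrreducible →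
      (∀ᶠ v : HeightOneSpectrum (𝓞 ℚ) in cofinite, ρ.IsUnramifiedAt v) →
      (∀ (v : HeightOneSpectrum (𝓞 ℚ)) (hv : ((2 : ℕ) : 𝓞 ℚ) ∈ v.asIdeal),
        (PAdicHodge.fontainePstAdicCompletion v 2 hv).IsDeRhamFramed (ρ.toLocal v) ∧
        ∀ τ : v.adicCompletion ℚ →+* PadicAlgCl 2, Continuous τ →
          (ρ.labelledHodgeTateWeightsAt v (PAdicHodge.fontainePstAdicCompletion v 2 hv).algebra
            (PAdicHodge.fontainePstAdicCompletion v 2 hv).𝔅 τ).Nodup) →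
      (∃ 𝒰 : BigHeckeGLn.TameLevel 2 ℚ 2, 𝒰.IsPadicallyAutomorphic ρ) →
      ∃ (χ : absoluteGaloisGroup ℚ →ₜ* (PadicAlgCl 2)ˣ) (m : ℤ),
        (∀ σ, χ σ = cyclotomicPadicAlgCl ℚ 2 σ ^ m) ∧
        ∃ (N : ℕ) (_ : NeZero N) (k : ℤ) (f : CuspForm (Gamma1 N) k)
          (ιf : coeffCharField f →+* PadicAlgCl 2),
          IsNewform1 f ∧ IsGaloisRepOfNewform1 f ιf {q | q ∣ N * 2} (FramedRep.twist ρ χ)) :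
    Pan2022_proModularDeRhamClassical_GL2Q := by
  intro p _ ρ hres hirr hunr hdR haut
  by_cases hp : p = 2
  · subst hp
    exact h2 ρ hres hirr hunr hdR haut
  · exact proModularDeRhamClassical_GL2Q_of_ne_two hX p hp ρ hirr hunr hdR haut

end Literature.NumberTheory.Automorphic

end
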